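import Summits.QuantumFields.YangMills.Theorems.ScalingWindowSplitCurvatureAmnesiaSlotEquicontinuity
import Summits.QuantumFields.YangMills.Theorems.ScalingWindowSplitCurvatureAmnesiaLatticeRotationGenerator
import HarnessLib

/-!
# The Ward insertion in lattice angular-momentum form, up to `o(1)`
# (crux stmt-QuantumFields-16192, line `WardDefectSketch`, sub-goal (W-exact a3))

Support file for the crux item stmt-QuantumFields-16192 (`CoincidenceRotationBootstrap.CurvatureAmnesia`, shared
verbatim with `ScalingWindowSplit.CurvatureAmnesia`), line `WardDefectSketch`.  Step (W-exact a) of the lattice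
rotation-Ward engine: in ONE slot `i` of the joint Wilson lattice `n`-point function
`LS_k(g) = latticeSchwinger r.ρ sch (·.F) k n σ g` (`YangMillsOS`), the continuum rotation-Ward insertion
`L fᵢ = x₁ ∂₀ fᵢ − x₀ ∂₁ fᵢ` equals, up to `o(1)` as `k → ∞`, MINUS the insertion of the lattice
angular-momentum density `c a⁴ Σ_y fᵢ(a y) [y₁ (O_y − O_{y − e₀'}) − y₀ (O_y − O_{y − e₁'})]`,
`O_y = O(τ_y Ũ)` (backward lattice differences of the translated observable), the other slots unchanged.
This file proves the registered sub-goal `wardInsertion_latticeAngularMomentum_tendsto`, a corollary of three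
landed theorems:

* `latticeSchwinger_update_diffQuotient_tendsto` (slot equicontinuity, twice: `p = x₁`, `v = e₀` and
  `p = x₀`, `v = e₁`) and slot linearity of `LS_k` (`exists_multilinearMap_latticeSchwinger`,
  `WardLatticeForm.latticeSchwinger_update_sub`): `LS_k(…, L fᵢ, …) − LS_k(…, D_{a_k} fᵢ, …) → 0` with
  the lattice difference-quotient rotation generator
  `D_a f = x₁ · a⁻¹ (f(· + a e₀) − f) − x₀ · a⁻¹ (f(· + a e₁) − f)`;
* `smearedLatticeField_latticeRotGen` (exact summation by parts on `ℤ⁴`): for all large `k` — as soon as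
  every lattice point `y` with `fᵢ(a_k y) ≠ 0` has `y`, `y − e₀'`, `y − e₁'` in the box, which holds
  eventually for the compactly supported `fᵢ` (`LatticeTranslation.eventually_mem_box_and_mem_box`,
  `WardLatticeForm.eventually_mem_box_iff`) — the slot-`i` smeared field of `D_{a_k} fᵢ` IS minus the lattice
  angular-momentum density, pointwise in the configuration (`WardLatticeForm.prod_update_diffQuot_eq`, splitting
  the product at the updated slot with `prod_apply_update_eq`), hence
  `LS_k(…, D_{a_k} fᵢ, …) = −∫ (∏_{j ≠ i} Φⱼ(fⱼ)) · (c a⁴ Σ_y …) dμ_k` eventually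
  (`WardLatticeForm.latticeSchwinger_update_diffQuot_eventually_eq`, `integral_neg`).

Everything is proved; no definitions, no notation.  References: folklore (bookkeeping on top of the cited
landed files).
-/

noncomputable section

namespace Summit.QuantumFields.YangMills.Cruxes.CurvatureAmnesia.WardDefect

open scoped BigOperators Topology SchwartzMap LineDeriv
open Filter MeasureTheory
open Literature.MathematicalPhysics.QuantumLattice Literature.MathematicalPhysics.AQFT
  Literature.MathematicalPhysics.QuantumFieldTheory
open Literature.Probability.LatticeModels (box)

namespace WardLatticeForm

/-! ### The box condition of the summation by parts holds eventually -/

/-- Along a scaling scheme (`a_k → 0`, `a_k L_k → ∞`), for compactly supported test functions `fᵢ`: for all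
large `k`, every lattice point `y` with `fᵢ (a_k y) ≠ 0` satisfies `y ∈ Λ_k ↔ y − e₀' ∈ Λ_k` and
`y ∈ Λ_k ↔ y − e₁' ∈ Λ_k` for the box `Λ_k = {-L_k, …, L_k}⁴` (both sides are true;
`LatticeTranslation.eventually_mem_box_and_mem_box` with the vectors `−e₀'`, `−e₁'`). [folklore] -/
theorem eventually_mem_box_iff {ι : Type} (sch : SpeciesScheme ι) {n : ℕ}
    (f : Fin n → 𝓢(EuclideanSpace ℝ (Fin 4), ℝ))
    (hf : ∀ i, HasCompactSupport (f i : EuclideanSpace ℝ (Fin 4) → ℝ)) :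
    ∀ᶠ k in atTop, ∀ i, ∀ y : Fin 4 → ℤ, f i (sch.a k • siteToE y) ≠ 0 →
      ((y ∈ box 4 (sch.L k) ↔ y - Pi.single 0 1 ∈ box 4 (sch.L k)) ∧
        (y ∈ box 4 (sch.L k) ↔ y - Pi.single 1 1 ∈ box 4 (sch.L k))) := by
  filter_upwards [LatticeTranslation.eventually_mem_box_and_mem_box sch f hf (-Pi.single 0 1),
    LatticeTranslation.eventually_mem_box_and_mem_box sch f hf (-Pi.single 1 1)] with k h0 h1 i y hy
  refine ⟨iff_of_true (h0 i y hy).1 ?_, iff_of_true (h1 i y hy).1 ?_⟩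
  · rw [sub_eq_add_neg]
    exact (h0 i y hy).2
  · rw [sub_eq_add_neg]
    exact (h1 i y hy).2

section Lattice

variable {G : Type} [MeasurableSpace G] [Group G]

/-! ### The integrand with the lattice rotation generator in slot `i`, pointwise -/

/-- **The integrand with the lattice rotation generator in slot `i`, pointwise**: under the box condition
at step `k`,
`∏ⱼ Φⱼ((update f i (D_{a_k} fᵢ))ⱼ)(Ũ) = −(∏_{j ≠ i} Φⱼ(fⱼ)(Ũ)) · (c a⁴ Σ_y fᵢ(a y) [y₁ (O_y − O_{y − e₀'}) − …])`
(split the product at the updated slot, `prod_apply_update_eq`, and sum by parts in slot `i`,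
`smearedLatticeField_latticeRotGen` with `a_k ≠ 0`). [folklore] -/
theorem prod_update_diffQuot_eq (sch : SpeciesScheme (YMSpecies G)) (k : ℕ) {n : ℕ} (σ : Fin n → YMSpecies G)
    (f : Fin n → 𝓢(EuclideanSpace ℝ (Fin 4), ℝ)) (i : Fin n) (U : GaugeConfig 4 (sch.side k) G)
    (h : ∀ y : Fin 4 → ℤ, f i (sch.a k • siteToE y) ≠ 0 →
      ((y ∈ box 4 (sch.L k) ↔ y - Pi.single 0 1 ∈ box 4 (sch.L k)) ∧
        (y ∈ box 4 (sch.L k) ↔ y - Pi.single 1 1 ∈ box 4 (sch.L k)))) :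
    ∏ j, smearedLatticeField ((σ j).F) (box 4 (sch.L k)) (sch.a k) (sch.c (σ j) k) (sch.m (σ j) k)
        (Function.update f i
          (SchwartzMap.smulLeftCLM ℝ (fun x : EuclideanSpace ℝ (Fin 4) => x 1)
              ((sch.a k)⁻¹ • (translateTest
                (-(sch.a k • (EuclideanSpace.single (0 : Fin 4) (1 : ℝ) : EuclideanSpace ℝ (Fin 4)))) (f i) -
                  f i)) -
            SchwartzMap.smulLeftCLM ℝ (fun x : EuclideanSpace ℝ (Fin 4) => x 0)
              ((sch.a k)⁻¹ • (translateTest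
                (-(sch.a k • (EuclideanSpace.single (1 : Fin 4) (1 : ℝ) : EuclideanSpace ℝ (Fin 4)))) (f i) -
                  f i))) j)
        (torusLift (sch.side k) U) =
      -((∏ j ∈ Finset.univ.erase i, smearedLatticeField ((σ j).F) (box 4 (sch.L k)) (sch.a k) (sch.c (σ j) k)
          (sch.m (σ j) k) (f j) (torusLift (sch.side k) U)) *
        (sch.c (σ i) k * sch.a k ^ 4 * ∑ y ∈ box 4 (sch.L k), f i (sch.a k • siteToE y) *
          (((y 1 : ℤ) : ℝ) * ((σ i).F (configShift (-y) (torusLift (sch.side k) U)) -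
              (σ i).F (configShift (-(y - Pi.single 0 1)) (torusLift (sch.side k) U))) -
            ((y 0 : ℤ) : ℝ) * ((σ i).F (configShift (-y) (torusLift (sch.side k) U)) -
              (σ i).F (configShift (-(y - Pi.single 1 1)) (torusLift (sch.side k) U)))))) := by
  refine (prod_apply_update_eq (fun j φ => smearedLatticeField ((σ j).F) (box 4 (sch.L k)) (sch.a k)
    (sch.c (σ j) k) (sch.m (σ j) k) φ (torusLift (sch.side k) U)) f i _).trans ?_
  rw [smearedLatticeField_latticeRotGen G ((σ i).F) (box 4 (sch.L k)) (sch.a k) (sch.c (σ i) k)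
    (sch.m (σ i) k) (sch.a_pos k).ne' (f i) (torusLift (sch.side k) U) h]
  ring

variable [TopologicalSpace G] [IsTopologicalGroup G] [CompactSpace G] [BorelSpace G]

/-! ### Slot linearity of the joint lattice `n`-point function -/

/-- **Slot linearity**: `LS_k(…, A − B, …) = LS_k(…, A, …) − LS_k(…, B, …)` (the joint lattice `n`-point
function is a multilinear form, `exists_multilinearMap_latticeSchwinger`). [folklore] -/
theorem latticeSchwinger_update_sub (r : LatticeRep G) (sch : SpeciesScheme (YMSpecies G)) (k : ℕ) {n : ℕ}
    (σ : Fin n → YMSpecies G) (f : Fin n → 𝓢(EuclideanSpace ℝ (Fin 4), ℝ)) (i : Fin n)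
    (A B : 𝓢(EuclideanSpace ℝ (Fin 4), ℝ)) :
    latticeSchwinger r.ρ sch (fun s => s.F) k n σ (Function.update f i (A - B)) =
      latticeSchwinger r.ρ sch (fun s => s.F) k n σ (Function.update f i A) -
        latticeSchwinger r.ρ sch (fun s => s.F) k n σ (Function.update f i B) := by
  obtain ⟨T, -, hT⟩ := exists_multilinearMap_latticeSchwinger r sch k σ
  rw [← hT, ← hT, ← hT, MultilinearMap.map_update_sub]

/-! ### The lattice rotation generator in slot `i`, integrated -/

/-- **The lattice rotation generator in slot `i`, integrated, eventually**: for compactly supported `fⱼ`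
and all large `k`,
`LS_k(…, D_{a_k} fᵢ, …) = −∫ (∏_{j ≠ i} Φⱼ(fⱼ)(Ũ)) · (c a⁴ Σ_y fᵢ(a y) [y₁ (O_y − O_{y − e₀'}) − …]) dμ_k(U)`
(`prod_update_diffQuot_eq` under the integral, once the box condition holds: `eventually_mem_box_iff`).
[folklore] -/
theorem latticeSchwinger_update_diffQuot_eventually_eq (r : LatticeRep G) (sch : SpeciesScheme (YMSpecies G))
    {n : ℕ} (σ : Fin n → YMSpecies G) (f : Fin n → 𝓢(EuclideanSpace ℝ (Fin 4), ℝ))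
    (hf : ∀ i, HasCompactSupport (f i : EuclideanSpace ℝ (Fin 4) → ℝ)) (i : Fin n) :
    ∀ᶠ k in atTop, latticeSchwinger r.ρ sch (fun s => s.F) k n σ (Function.update f i
        (SchwartzMap.smulLeftCLM ℝ (fun x : EuclideanSpace ℝ (Fin 4) => x 1)
            ((sch.a k)⁻¹ • (translateTest
              (-(sch.a k • (EuclideanSpace.single (0 : Fin 4) (1 : ℝ) : EuclideanSpace ℝ (Fin 4)))) (f i) -
                f i)) -
          SchwartzMap.smulLeftCLM ℝ (fun x : EuclideanSpace ℝ (Fin 4) => x 0)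
            ((sch.a k)⁻¹ • (translateTest
              (-(sch.a k • (EuclideanSpace.single (1 : Fin 4) (1 : ℝ) : EuclideanSpace ℝ (Fin 4)))) (f i) -
                f i)))) =
      -∫ U, (∏ j ∈ Finset.univ.erase i, smearedLatticeField ((σ j).F)
          (Literature.Probability.LatticeModels.box 4 (sch.L k)) (sch.a k) (sch.c (σ j) k) (sch.m (σ j) k) (f j)
          (torusLift (sch.side k) U)) *
        (sch.c (σ i) k * sch.a k ^ 4 * ∑ y ∈ Literature.Probability.LatticeModels.box 4 (sch.L k),
          f i (sch.a k • siteToE y) *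
            (((y 1 : ℤ) : ℝ) * ((σ i).F (configShift (-y) (torusLift (sch.side k) U)) -
                (σ i).F (configShift (-(y - Pi.single 0 1)) (torusLift (sch.side k) U))) -
              ((y 0 : ℤ) : ℝ) * ((σ i).F (configShift (-y) (torusLift (sch.side k) U)) -
                (σ i).F (configShift (-(y - Pi.single 1 1)) (torusLift (sch.side k) U)))))
        ∂(wilsonMeasure (d := 4) (L := sch.side k) r.ρ (sch.β k)) := by
  filter_upwards [eventually_mem_box_iff sch f hf] with k hk
  rw [← integral_neg]
  unfold latticeSchwinger
  exact integral_congr_ae (ae_of_all _ fun U => prod_update_diffQuot_eq sch k σ f i U (hk i))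

end Lattice

end WardLatticeForm

/-- **(W-exact a3) The Ward insertion in lattice angular-momentum form, up to `o(1)`, under the tie.**
For a real family `f` with compact, pairwise disjoint supports and a slot `i`, the Ward insertion
`LS_k(…, x₁ ∂₀ fᵢ − x₀ ∂₁ fᵢ, …)` plus the insertion of the lattice angular-momentum density
`∫ (∏_{j ≠ i} Φⱼ(fⱼ)(Ũ)) · (c a⁴ Σ_y fᵢ(a y) [y₁ (O_y − O_{y − e₀'}) − y₀ (O_y − O_{y − e₁'})]) dμ_k` tends to `0`:
the continuum insertion is replaced by the lattice difference-quotient one up to `o(1)`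
(`latticeSchwinger_update_diffQuotient_tendsto`, twice, and slot linearity), and the latter is summed by parts
exactly for all large `k` (`smearedLatticeField_latticeRotGen`); see the file header. [folklore] -/
theorem wardInsertion_latticeAngularMomentum_tendsto : ∀ (G : Type) [Group G] [TopologicalSpace G] [IsTopologicalGroup G] [CompactSpace G] [MeasurableSpace G] [BorelSpace G] (r : LatticeRep G) (sch : SpeciesScheme (YMSpecies G)) (S : LabelledSchwingerFamily (YMSpecies G) (EuclideanSpace ℝ (Fin 4))), (∀ (n : ℕ), n ≠ 0 → ∀ (σ : Fin n → YMSpecies G) (f : Fin n → 𝓢(EuclideanSpace ℝ (Fin 4), ℝ)) (F : 𝓢((Fin n → EuclideanSpace ℝ (Fin 4)), ℂ)), IsTensorOf F (fun i => ofRealTest (f i)) → IsOffDiagonal F → Tendsto (fun k : ℕ => ((latticeSchwinger r.ρ sch (fun s => s.F) k n σ f : ℝ) : ℂ)) atTop (𝓝 (S n σ F))) → ∀ (n : ℕ) (σ : Fin n → YMSpecies G) (f : Fin n → 𝓢(EuclideanSpace ℝ (Fin 4), ℝ)), ((∀ i, HasCompactSupport (f i : EuclideanSpace ℝ (Fin 4)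 → ℝ)) ∧ ∀ i j, i ≠ j → Disjoint (tsupport (f i : EuclideanSpace ℝ (Fin 4) → ℝ)) (tsupport (f j : EuclideanSpace ℝ (Fin 4) → ℝ))) → ∀ (i : Fin n), Tendsto (fun k : ℕ => latticeSchwinger r.ρ sch (fun s => s.F) k n σ (Function.update f i (SchwartzMap.smulLeftCLM ℝ (fun x : EuclideanSpace ℝ (Fin 4) => x 1) (LineDeriv.lineDerivOp (EuclideanSpace.single (0 : Fin 4) (1 : ℝ) : EuclideanSpace ℝ (Fin 4)) (f i)) - SchwartzMap.smulLeftCLM ℝ (fun x : EuclideanSpace ℝ (Fin 4) => x 0) (LineDeriv.lineDerivOp (EuclideanSpace.single (1 : Fin 4) (1 : ℝ) : EuclideanSpace ℝ (Fin 4)) (f i)))) + ∫ U, (∏ j ∈ Finset.univ.erase i, smearedLatticeField ((σ j).F) (Literature.Probability.LatticeModels.box 4 (sch.L k)) (sch.a k) (sch.c (σ j) k) (sch.m (σ j) k) (f j) (torusLift (sch.side k) U)) * (sch.c (σ i) k * sch.a k ^ 4 * ∑ y ∈ Literature.Probability.LatticeModels.box 4 (sch.L k), f i (sch.a k • siteToE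 y) * (((y 1 : ℤ) : ℝ) * ((σ i).F (configShift (-y) (torusLift (sch.side k) U)) - (σ i).F (configShift (-(y - Pi.single 0 1)) (torusLift (sch.side k) U))) - ((y 0 : ℤ) : ℝ) * ((σ i).F (configShift (-y) (torusLift (sch.side k) U)) - (σ i).F (configShift (-(y - Pi.single 1 1)) (torusLift (sch.side k) U))))) ∂(wilsonMeasure (d := 4) (L := sch.side k) r.ρ (sch.β k))) atTop (𝓝 0) := by
  intro G _ _ _ _ _ _ r sch S hTie n σ f hf i
  -- (1) replace `∂₀`, `∂₁` by the lattice difference quotients, up to `o(1)` (slot equicontinuity)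
  have h0 := latticeSchwinger_update_diffQuotient_tendsto G r sch S hTie n σ f hf i
    (EuclideanSpace.single (0 : Fin 4) (1 : ℝ) : EuclideanSpace ℝ (Fin 4))
    (fun x : EuclideanSpace ℝ (Fin 4) => x 1) (hasTemperateGrowth_coord 1)
  have h1 := latticeSchwinger_update_diffQuotient_tendsto G r sch S hTie n σ f hf i
    (EuclideanSpace.single (1 : Fin 4) (1 : ℝ) : EuclideanSpace ℝ (Fin 4))
    (fun x : EuclideanSpace ℝ (Fin 4) => x 0) (hasTemperateGrowth_coord 0)
  have h01 := h0.sub h1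
  rw [sub_zero] at h01
  -- (2)-(3) the difference-quotient insertion is summed by parts exactly, eventually
  refine h01.congr' ?_
  filter_upwards [WardLatticeForm.latticeSchwinger_update_diffQuot_eventually_eq r sch σ f hf.1 i]
    with k hk
  rw [WardLatticeForm.latticeSchwinger_update_sub] at hk
  rw [WardLatticeForm.latticeSchwinger_update_sub]
  linarith

end Summit.QuantumFields.YangMills.Cruxes.CurvatureAmnesia.WardDefect

end
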